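import Literature.Topology.FourManifolds.RLinkSphere
import Literature.Topology.FourManifolds.FramedTubeDiffeotopy
import Literature.Topology.FourManifolds.HandleAttachingMapsTransport
import Literature.Topology.FourManifolds.HandleAttachingMapsUniqueness
import Literature.Topology.FourManifolds.CollarTheorem
import Literature.Geometry.Symplectic.TwoHandleIsotopyHolds
import Literature.Geometry.Symplectic.AttachingCircleProofs
import Literature.Geometry.Manifold.EmbeddingRangeDiffeomorph
import HarnessLib

/-!
# Uniqueness of the trace of a framed knot: `X_m(K)` only depends on the knot type and the framing

Topic `Literature/Topology/FourManifolds` (support file for the named fact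
`exists_framedKnot_of_hasHandleDecomposition_oneZeroOne` of `PropertyRTraceClosing.lean`, the trace
bridge T of the SPC4 crux `AcyclicBisectionRigidity`, clause (ii): uniqueness of the trace of the
`0`-framed unknot).  Everything here is **proved**; no definition and no named fact is introduced.

The compact trace `X_m(K) = B⁴ ∪_{(K, m)} h²` of a framed knot is the tree's
`(FramedLink.single K m).IsTrace P` (`RLinkSphere.lean`, `DottedCircleDiagram.lean`): `P` is the
`4`-ball `𝔻 4` (no dotted circles) with one `2`-handle attached in Kosinski's sense
(`HandleAttachingMap.IsMultiAttachment`) along an attaching map whose boundary tube, read in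
`S³ = ∂B⁴`, is an oriented tubular neighbourhood `ν` of `K` with `ν.HasFraming m`.  Kirby,
*The Topology of 4-Manifolds* (1989), Ch. I §1: handlebodies are determined by their attaching
maps up to isotopy; Kosinski, *Differential Manifolds* (1993), VI (6.6): *"if the attaching
spheres are isotopic the resulting manifolds are diffeomorphic"*; Gompf–Stipsicz (1999), §4.4,
§5.3: `X_m(K)` depends only on the isotopy class of `K` and the integer `m`.

* `DottedCircleDiagram.Realization.exists_carvedDiffeomorph` — for a diagram without dotted
  circles the carved ball of a realization IS `𝔻 4`: the comparison diffeomorphism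
  `E : X₁ ≅ 𝔻 4` with `E x = carvedEmbed x` (`carvedEmbed` is a surjective smooth open embedding;
  Lee 2013, Thm. 5.31, `exists_diffeomorph_comp_eq_of_range_eq`).
* `FramedLink.IsTrace.nonempty_diffeomorph_of_isIsotopic` — **if `P` is a trace of `(K, m)` and
  `P'` a trace of `(K', m)` with `K`, `K'` ambient isotopic, then `P ≅ P'`.**  Proof: transport
  both attachments to `𝔻 4` along `E`, `E'` (`IsMultiAttachment.transport`); match the boundary
  tubes `ν`, `ν'` by a diffeotopy `D` of `S³`
  (`Knot.TubularNbhd.exists_diffeotopy_eq_of_isIsotopic`, `FramedTubeDiffeotopy.lean`); slide `D`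
  over a collar of `𝔻 4` (`BoundaryData.Collar.slideExtension`, `slideExtension_comp_incl`;
  Hirsch 1976, Ch. 8 §2) to a self-diffeomorphism `G` of `𝔻 4` and transport once more: the
  resulting attaching map agrees with that of `P'` on `T ∩ ∂D⁴` near the attaching circle, so the
  two have the same attaching circle and the same handle framing
  (`attachingFraming_eq_mfderiv_comp_tubeArcPt`), and Step 2 of ISO
  (`isMultiAttachment_of_sameCircle'`, `TwoHandleIsotopyHolds.lean`: same circle, homotopic
  framings) makes `P` an attachment along the attaching map of `P'`; two attachments along the
  same attaching maps are diffeomorphic (`IsMultiAttachment.nonempty_diffeomorph`).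
* `FramedLink.IsTrace.nonempty_diffeomorph` — in particular two traces of the same framed knot
  are diffeomorphic.

## References

* R. C. Kirby, *The Topology of 4-Manifolds*, LNM 1374 (1989), Ch. I §1–§2. [Kirby1989]
* A. A. Kosinski, *Differential Manifolds*, Academic Press (1993), VI §6, (6.6); VI §1 proof of
  (1.1). [Kosinski1993]
* R. E. Gompf, A. I. Stipsicz, *4-Manifolds and Kirby Calculus*, GSM 20 (1999), §4.4, §5.3.
  [GompfStipsicz1999]
* M. W. Hirsch, *Differential Topology*, GTM 33 (1976), Ch. 8 §2, proof of Thm. 2.3. [HirschDT1976]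
-/

noncomputable section

open Set Function Metric Filter
open scoped Manifold ContDiff Topology

namespace Literature.Topology.FourManifolds

open Literature.Geometry.Symplectic

/-! ### The carved ball of a diagram without dotted circles is `𝔻 4` -/

namespace DottedCircleDiagram.Realization

variable {ι κ : Type*} [Finite ι] [Finite κ] [IsEmpty ι] {D : DottedCircleDiagram ι κ}
  {W : Type*} [TopologicalSpace W] [ChartedSpace (EuclideanHalfSpace 4) W]

/-- With no dotted circles every point of the carved ball lies off the (absent) dual attaching
circles. [folklore] -/
theorem mem_coresComplement_dual (R : D.Realization W) (x : R.carved) :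
    x ∈ HandleAttachingMap.coresComplement R.dual :=
  (HandleAttachingMap.mem_coresComplement R.dual).2 fun i => isEmptyElim i

/-- With no dotted circles `carvedEmbed` is onto `𝔻 4`. [folklore] -/
theorem range_carvedEmbed_eq_univ (R : D.Realization W) : range R.carvedEmbed = univ := by
  have h := R.cover_closedBall
  rwa [iUnion_of_empty, union_empty] at h

/-- **For a diagram without dotted circles the carved ball of a realization is the `4`-ball**:
a diffeomorphism `E : X₁ ≅ 𝔻 4` which is `carvedEmbed` on points (a surjective smooth embedding
is a diffeomorphism onto its image; Lee 2013, Thm. 5.31). [cite: LeeSmoothManifolds2013, Thm. 5.31] -/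
theorem exists_carvedDiffeomorph (R : D.Realization W) :
    ∃ E : R.carved ≃ₘ⟮𝓡∂ 4, 𝓡∂ 4⟯ (Metric.closedBall (0 : EuclideanSpace ℝ (Fin 4)) 1),
      ∀ (x : R.carved) (hx : x ∈ HandleAttachingMap.coresComplement R.dual),
        E x = R.carvedEmbed ⟨x, hx⟩ := by
  -- the carved ball is its own "complement of the dual cores"
  let e₀ : R.carved ≃ₘ⟮𝓡∂ 4, 𝓡∂ 4⟯ ↥(HandleAttachingMap.coresComplement R.dual) :=
    { toFun := fun x => ⟨x, R.mem_coresComplement_dual x⟩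
      invFun := Subtype.val
      left_inv := fun _ => rfl
      right_inv := fun _ => rfl
      contMDiff_toFun :=
        (ContMDiff.subtypeVal_comp_iff (HandleAttachingMap.coresComplement R.dual) _).1 contMDiff_id
      contMDiff_invFun := contMDiff_subtype_val }
  obtain ⟨Φ₀, hΦ₀⟩ := Literature.Geometry.Manifold.exists_diffeomorph_comp_eq_of_range_eq
    R.isSmoothEmbedding_carvedEmbed
    (Manifold.IsSmoothEmbedding.id (I := 𝓡∂ 4)
      (M := Metric.closedBall (0 : EuclideanSpace ℝ (Fin 4)) 1))
    (by rw [R.range_carvedEmbed_eq_univ, range_id])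
  exact ⟨e₀.trans Φ₀, fun x hx => hΦ₀ ⟨x, hx⟩⟩

end DottedCircleDiagram.Realization

/-! ### Uniqueness of the trace of a framed knot -/

namespace FramedLink.IsTrace

/-- **The trace `X_m(K)` of a framed knot only depends on the knot type of `K` and on `m`.**  If
`P` is a trace of `(K, m)` and `P'` a trace of `(K', m)` (`FramedLink.IsTrace`) with `K`, `K'`
ambient isotopic (`Knot.IsIsotopic`), then `P ≅ P'`.  Kirby (1989), Ch. I §1 (handlebodies are
determined by the isotopy classes of the attaching maps); Kosinski (1993), VI (6.6) (*"if the
attaching spheres are isotopic the resulting manifolds are diffeomorphic"*); Gompf–Stipsicz (1999),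
§5.3.  See the module docstring for the proof (tube matching in `S³` by a diffeotopy, slide over a
collar of `B⁴`, Step 2 of ISO, uniqueness of attachments). [cite: Kosinski1993, VI (6.6)]
[cite: Kirby1989, Ch. I §1] [cite: GompfStipsicz1999, §5.3] -/
theorem nonempty_diffeomorph_of_isIsotopic {P P' : Type} [TopologicalSpace P]
    [ChartedSpace (EuclideanHalfSpace 4) P] [IsManifold (𝓡∂ 4) ∞ P] [TopologicalSpace P']
    [ChartedSpace (EuclideanHalfSpace 4) P'] [IsManifold (𝓡∂ 4) ∞ P'] {K K' : Knot} {m : ℤ}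
    (h : (FramedLink.single K m).IsTrace P) (h' : (FramedLink.single K' m).IsTrace P')
    (hK : K.IsIsotopic K') : Nonempty (P ≃ₘ⟮𝓡∂ 4, 𝓡∂ 4⟯ P') := by
  obtain ⟨R⟩ := h
  obtain ⟨R'⟩ := h'
  -- Step 0: the carved balls are `𝔻 4`; transport the attachments there
  obtain ⟨E, hE⟩ := R.exists_carvedDiffeomorph
  obtain ⟨E', hE'⟩ := R'.exists_carvedDiffeomorph
  set ι₃ := (closedBallBoundaryData 3).incl with hι₃
  have hP₁ : HandleAttachingMap.IsMultiAttachment (fun j => (R.handle j).transport E) (𝓡∂ 4) P :=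
    R.isMultiAttachment_handle.transport E
  have hP' : HandleAttachingMap.IsMultiAttachment (fun j => (R'.handle j).transport E') (𝓡∂ 4) P' :=
    R'.isMultiAttachment_handle.transport E'
  -- boundary values of the transported attaching maps
  have hbd : ∀ (j : Fin 1) (y : ↥(handleTube 3 2)), tubeDepth y = 0 →
      ((R.handle j).transport E).toFun y = ι₃ (R.tube j (tubeAngle y, tubeFibre y)) := fun j y hy => by
    rw [HandleAttachingMap.transport_apply, hE _ (R.handle_mem j y), R.carvedEmbed_handle j y hy]
  have hbd' : ∀ (j : Fin 1) (y : ↥(handleTube 3 2)), tubeDepth y = 0 →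
      ((R'.handle j).transport E').toFun y = ι₃ (R'.tube j (tubeAngle y, tubeFibre y)) :=
    fun j y hy => by
    rw [HandleAttachingMap.transport_apply, hE' _ (R'.handle_mem j y), R'.carvedEmbed_handle j y hy]
  -- Step 1: match the boundary tubes by a diffeotopy of `S³`
  obtain ⟨Dt, r, hr, hDt⟩ := Knot.TubularNbhd.exists_diffeotopy_eq_of_isIsotopic hK
    (R.tube 0) (R'.tube 0) (R.hasFraming_tube 0) (R'.hasFraming_tube 0)
  -- Step 2: slide it over a collar of `𝔻 4`
  haveI : CompactSpace (closedBallBoundaryData 3).carrier :=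
    (inferInstance : CompactSpace (Metric.sphere (0 : EuclideanSpace ℝ (Fin 4)) 1))
  obtain ⟨c⟩ := BoundaryData.nonempty_collar_of_compactSpace 2
    (Metric.closedBall (0 : EuclideanSpace ℝ (Fin 4)) 1) (closedBallBoundaryData 3)
  set G := c.slideExtension Dt with hG
  have hGι : ∀ x, G (ι₃ x) = ι₃ (Dt.toFun 1 x) := fun x =>
    congrFun (c.slideExtension_comp_incl Dt) x
  set g : Fin 1 → HandleAttachingMap 3 2 (Metric.closedBall (0 : EuclideanSpace ℝ (Fin 4)) 1) :=
    fun j => ((R.handle j).transport E).transport G with hg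
  set k : Fin 1 → HandleAttachingMap 3 2 (Metric.closedBall (0 : EuclideanSpace ℝ (Fin 4)) 1) :=
    fun j => (R'.handle j).transport E' with hk
  have hP₂ : HandleAttachingMap.IsMultiAttachment g (𝓡∂ 4) P := hP₁.transport G
  -- Step 3: `g` and `k` agree on `T ∩ ∂D⁴` near the attaching circle
  have hagree : ∀ (j : Fin 1) (y : ↥(handleTube 3 2)), tubeDepth y = 0 → ‖tubeFibre y‖ < r →
      (g j).toFun y = (k j).toFun y := by
    intro j y hy hyr
    have hj : j = 0 := Subsingleton.elim j 0
    subst hj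
    show G (((R.handle 0).transport E).toFun y) = ((R'.handle 0).transport E').toFun y
    rw [hbd 0 y hy, hbd' 0 y hy, hGι]
    exact congrArg ι₃ (hDt (tubeAngle y) (tubeFibre y) hyr)
  have hcirc : ∀ j, (g j).attachingCircle = (k j).attachingCircle := fun j => by
    funext θ
    show (g j).toFun (coreTubePt θ) = (k j).toFun (coreTubePt θ)
    exact hagree j (coreTubePt θ) (tubeDepth_coreTubePt θ) (by rw [tubeFibre_coreTubePt, norm_zero]; exact hr)
  have hfram : ∀ j, (g j).attachingFraming = (k j).attachingFraming := fun j => by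
    funext θ
    rw [attachingFraming_eq_mfderiv_comp_tubeArcPt, attachingFraming_eq_mfderiv_comp_tubeArcPt]
    have hev : ((g j).toFun ∘ tubeArcPt θ) =ᶠ[𝓝 0] ((k j).toFun ∘ tubeArcPt θ) := by
      have hsin : ∀ᶠ s in 𝓝 (0 : ℝ), |Real.sin s| < r := by
        have : Tendsto (fun s => |Real.sin s|) (𝓝 0) (𝓝 |Real.sin 0|) :=
          (Real.continuous_sin.abs).continuousAt
        rw [Real.sin_zero, abs_zero] at this
        exact this.eventually (eventually_lt_nhds hr)
      filter_upwards [eventually_cos_pos, hsin] with s hs hs'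
      refine hagree j (tubeArcPt θ s) (tubeDepth_tubeArcPt θ s) ?_
      rw [tubeFibre_tubeArcPt hs, norm_smul, Real.norm_eq_abs, PiLp.norm_single, norm_one, mul_one]
      exact hs'
    exact congrFun (congrArg DFunLike.coe hev.mfderiv_eq) 1
  have hfr : ∀ j, FramingHomotopic (k j).attachingCircle (g j).attachingFraming (k j).attachingFraming :=
    fun j => by
    rw [hfram j]
    exact FramingHomotopic.refl (isBoundaryKnot_attachingCircle (k j))
      (isKnotFraming_attachingFraming (k j))
  have hdisj' : Pairwise fun i j => Disjoint (range (k i).toFun) (range (k j).toFun) :=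
    fun i j hij => absurd (Subsingleton.elim i j) hij
  -- Step 4: ISO Step 2 and uniqueness of attachments
  have hfin : HandleAttachingMap.IsMultiAttachment k (𝓡∂ 4) P :=
    isMultiAttachment_of_sameCircle' g k hcirc hfr hdisj' hP₂
  exact hfin.nonempty_diffeomorph hP'

/-- **Two traces of the same framed knot are diffeomorphic** (the case `K' = K` of
`nonempty_diffeomorph_of_isIsotopic`; Kosinski 1993, VI §6 with VI §1 proof of (1.1) and III (3.5):
the attachment depends only on the attaching map, and two attaching maps along tubes of the same
knot with the same framing integer give the same manifold). [cite: Kosinski1993, VI (6.6)] -/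
theorem nonempty_diffeomorph {P P' : Type} [TopologicalSpace P]
    [ChartedSpace (EuclideanHalfSpace 4) P] [IsManifold (𝓡∂ 4) ∞ P] [TopologicalSpace P']
    [ChartedSpace (EuclideanHalfSpace 4) P'] [IsManifold (𝓡∂ 4) ∞ P'] {K : Knot} {m : ℤ}
    (h : (FramedLink.single K m).IsTrace P) (h' : (FramedLink.single K m).IsTrace P') :
    Nonempty (P ≃ₘ⟮𝓡∂ 4, 𝓡∂ 4⟯ P') :=
  nonempty_diffeomorph_of_isIsotopic h h' (SphereEmbedding.IsIsotopic.refl K)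

end FramedLink.IsTrace

end Literature.Topology.FourManifolds

end
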